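import Summits.ValiantsHypothesis.ValiantsHypothesis.Theorems.DivisionGapZeroOneTransferProjClosure
import Literature.Computability.AlgebraicComplexity.IMMInVPProofs

/-!
# Crux `ZeroOneTransfer` (stmt-ValiantsHypothesis-5066), line `hidden-markov-intertwiner` —
stub `stub_divSubstClosure`: division certificates transport along ARBITRARY monotone polynomial
substitutions over `ℝ≥0`, zero data included, at cost `Σ_i L(φ i)`

`stub_divSubstClosure`: for `p ∈ ℝ≥0[ι]` (`ι` finite), a substitution `φ : ι → ℝ≥0[τ]` (the zero
polynomial ALLOWED among the `φ i`) and every nonzero `h ∈ ℝ≥0[ι]` there is a nonzero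
`h' ∈ ℝ≥0[τ]` with `L(p(φ) · h') ≤ L(p h) + Σ_i L(φ i)` and `L(h') ≤ L(h) + Σ_i L(φ i)`, `L` the
tree's fan-in-two `complexity` over the semiring `ℝ≥0` (monotone circuit size, constants free).
It generalises `stub_projClosure` (`Theorems/DivisionGapZeroOneTransferProjClosure.lean`: `φ` a
Valiant projection, substitution free) and is the transport half of the line's engine
`SubMarkovDetDivisionEasy` (forest polynomials under sparse monotone substitutions are
division-easy).

## Proof

Exactly `ProjClosure.exists_cofactor` with the projection bound `complexity_le_of_isProjection`
replaced by the substitution bound `complexity_aeval_le` (`L(r(φ')) ≤ L(r) + Σ_i L(φ' i)`,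
Bürgisser 2000, Rem. 2.7).  Let `Z := {i | φ i = 0}`, `w` the indicator weight of `Z`, and `φ'` the
nowhere-zero companion of `φ` (`φ' i = 1` on `Z`, `φ' i = φ i` off `Z`; `L(1) = 0`, so
`Σ_i L(φ' i) ≤ Σ_i L(φ i)`).  Put `h' := (bot_w h)(φ')`, `bot_w` the bottom `w`-component
(`ProjClosure.botComponent`, part `…ProjClosureAux.lean`).

* `h' ≠ 0`: `bot_w h ≠ 0` (`botComponent_ne_zero`) and a NOWHERE-ZERO substitution keeps nonzero
  polynomials nonzero over `ℝ≥0` — evaluate at the all-ones point: every `φ' i` is nonzero there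
  (`eval_ne_zero_of_ne_zero'`), hence so is `(bot_w h)(φ')` (`eval_aeval_eq'`).
* `L(h') ≤ L(bot_w h) + Σ L(φ' i) ≤ L(h) + Σ L(φ i)` (`complexity_aeval_le`, bottom forms are free:
  `complexity_botComponent_le`).
* If `botDegree w p ≠ 0` then `p(φ) = 0` (`aeval_eq_zero_of_botDegree_ne_zero`) and `L(0) = 0`.
  Otherwise `p(φ) = (bot_w p)(φ')` (`aeval_eq_aeval_botComponent`), so
  `p(φ) · h' = (bot_w p · bot_w h)(φ') = (bot_w (p h))(φ')` (`botComponent_mul`, no cancellation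
  over `ℝ≥0`) and `L(p(φ) h') ≤ L(bot_w (p h)) + Σ L(φ' i) ≤ L(p h) + Σ L(φ i)`.

Helper namespace `DivSubstClosure`; imports `…ProjClosure` and `Literature` only (no `Theses`
file). [folklore]
-/

noncomputable section

-- `Summit.ValiantsHypothesis.ValiantsHypothesis.…` is the tree's mandated single-conjunct layout
-- (Sub = Summit), so the duplicated namespace component is intended.
set_option linter.dupNamespace false

namespace Summit.ValiantsHypothesis.ValiantsHypothesis.Theorems.DivisionGapZeroOneTransfer

open Literature.Computability.AlgebraicComplexity
open MvPolynomial Finset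
open scoped NNReal

namespace DivSubstClosure

open ProjClosure

variable {ι τ : Type*}

/-- A NOWHERE-ZERO substitution keeps nonzero polynomials nonzero over `ℝ≥0`: evaluate at the
all-ones point, where every substituted polynomial is nonzero (generalises
`ProjClosure.aeval_ne_zero_of_pos'`, positive projections). [folklore] -/
theorem aeval_ne_zero_of_ne_zero (e : ι → MvPolynomial τ ℝ≥0) (he : ∀ i, e i ≠ 0)
    {p : MvPolynomial ι ℝ≥0} (hp : p ≠ 0) : aeval e p ≠ 0 := by
  intro h0
  have h1 : eval (fun _ => (1 : ℝ≥0)) (aeval e p) = 0 := by rw [h0, map_zero]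
  rw [eval_aeval_eq'] at h1
  exact eval_ne_zero_of_ne_zero' hp (y := fun i => eval (fun _ => (1 : ℝ≥0)) (e i))
    (fun i => eval_ne_zero_of_ne_zero' (he i) fun _ => one_ne_zero) h1

/-- `L(1) = 0` (a gate-free circuit). [folklore] -/
theorem complexity_one : complexity (1 : MvPolynomial τ ℝ≥0) = 0 := by
  rw [← C_1]; exact complexity_C_holds 1

variable {a a' : ι → MvPolynomial τ ℝ≥0} {w : ι → ℕ}

/-- **Main lemma.** For a substitution `a`, the indicator weight `w` of `Z = {i | a i = 0}` and a
NOWHERE-ZERO substitution `a'` agreeing with `a` off `Z` and termwise no costlier than `a`: for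
every nonzero cofactor `h` the cofactor `h' := (bot_w h)(a')` is nonzero,
`L(p(a) · h') ≤ L(p h) + Σ_i L(a i)` and `L(h') ≤ L(h) + Σ_i L(a i)`. [folklore] -/
theorem exists_cofactor [Fintype ι] (hw : ∀ i, w i = 0 ↔ a i ≠ 0)
    (ha' : ∀ i, a i ≠ 0 → a' i = a i) (hne : ∀ i, a' i ≠ 0)
    (hcost : ∀ i, complexity (a' i) ≤ complexity (a i))
    (p : MvPolynomial ι ℝ≥0) {h : MvPolynomial ι ℝ≥0} (hh : h ≠ 0) :
    ∃ h' : MvPolynomial τ ℝ≥0, h' ≠ 0 ∧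
      complexity (aeval a p * h') ≤ complexity (p * h) + ∑ i, complexity (a i) ∧
      complexity h' ≤ complexity h + ∑ i, complexity (a i) := by
  have hsum : ∑ i, complexity (a' i) ≤ ∑ i, complexity (a i) :=
    Finset.sum_le_sum fun i _ => hcost i
  have hsub : ∀ r : MvPolynomial ι ℝ≥0,
      complexity (aeval a' (botComponent w r)) ≤ complexity r + ∑ i, complexity (a i) :=
    fun r => (complexity_aeval_le _ _).trans
      (Nat.add_le_add (complexity_botComponent_le w r) hsum)
  refine ⟨aeval a' (botComponent w h),
    aeval_ne_zero_of_ne_zero a' hne (botComponent_ne_zero w hh), ?_, hsub h⟩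
  by_cases hbd : botDegree w p = 0
  · rw [aeval_eq_aeval_botComponent hw ha' hbd, ← map_mul, ← botComponent_mul]
    exact hsub _
  · rw [aeval_eq_zero_of_botDegree_ne_zero hw hbd, zero_mul, complexity_zero]
    exact Nat.zero_le _

end DivSubstClosure

/-- **stub `stub_divSubstClosure` — substitution closure with zeros** (engine half M of line
`hidden-markov-intertwiner`): every division certificate of `p ∈ ℝ≥0[ι]` transports along an
ARBITRARY monotone polynomial substitution `φ : ι → ℝ≥0[τ]` (zero polynomials allowed) at cost
`Σ_i L(φ i)` — for every nonzero `h` there is a nonzero `h'` with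
`L(p(φ) · h') ≤ L(p h) + Σ_i L(φ i)` and `L(h') ≤ L(h) + Σ_i L(φ i)`, `L` the fan-in-two circuit
size over the semiring `ℝ≥0`.  Proof: `DivSubstClosure.exists_cofactor` with `w` the indicator of
`Z = {i | φ i = 0}` and `φ' = φ` off `Z`, `φ' = 1` on `Z`. [folklore] -/
theorem stub_divSubstClosure :
    ∀ (ι τ : Type) [Fintype ι] (p : MvPolynomial ι NNReal) (φ : ι → MvPolynomial τ NNReal)
      (h : MvPolynomial ι NNReal), h ≠ 0 →
      ∃ h' : MvPolynomial τ NNReal, h' ≠ 0 ∧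
        Literature.Computability.AlgebraicComplexity.complexity (MvPolynomial.aeval φ p * h') ≤
          Literature.Computability.AlgebraicComplexity.complexity (p * h) +
            ∑ i, Literature.Computability.AlgebraicComplexity.complexity (φ i) ∧
        Literature.Computability.AlgebraicComplexity.complexity h' ≤
          Literature.Computability.AlgebraicComplexity.complexity h +
            ∑ i, Literature.Computability.AlgebraicComplexity.complexity (φ i) := by
  intro ι τ _ p φ h hh
  classical
  refine DivSubstClosure.exists_cofactor (w := fun i => if φ i = 0 then 1 else 0)
    (a' := fun i => if φ i = 0 then 1 else φ i) (fun i => by simp) (fun i hi => if_neg hi)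
    (fun i => ?_) (fun i => ?_) p hh
  · by_cases h0 : φ i = 0
    · rw [if_pos h0]; exact one_ne_zero
    · rw [if_neg h0]; exact h0
  · by_cases h0 : φ i = 0
    · rw [if_pos h0, DivSubstClosure.complexity_one]; exact Nat.zero_le _
    · exact le_of_eq (by rw [if_neg h0])

end Summit.ValiantsHypothesis.ValiantsHypothesis.Theorems.DivisionGapZeroOneTransfer
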